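import Mathlib
import Literature.Analysis.FluidPDE.HardSphereFlowOrbits
import Summits.AtomisticToContinuum.HydrodynamicLimit.Theses.LambertianContactSwap
import HarnessLib

/-!
# The exact hybrid (Trotter–Lindeberg) swap identity
# (`LambertianContactSwap.SwapIdentity`, stmt-AtomisticToContinuum-12100)

`Φ_t` is the library's collision-by-collision hard-sphere flow (`Alexander.fwdFlow`) and
`Λ_t(z, ξ)` the *Lambertian* flow of route `LambertianContactSwap` (same free flights and exit
times; at the `k`-th contact the pair's outgoing relative velocity is redrawn along
`normalize(ω̂ + ξ̂_k)`, `ξ_k` i.i.d. standard Gaussian; an inline `let` block of the route file).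
With `P⁰_u F (y) := E F(Λ_u(y, ·))` the identity
`F(Φ_t z) − P⁰_t F(z) = Σ_{m < K_t(z)} [P⁰_{t−t_{m+1}} F (z_{m+1}) − ∫ P⁰_{t−t_{m+1}} F (lstep_ξ z_m) γ(dξ)]`
is the telescoping sum of `H_m := P⁰_{t−t_m} F (z_m)` over the deterministic collision sequence:
`H_K = F(Φ_t z)` since `t − t_K < τ(z_K)` (the Lambertian flow from `z_K` is still in its
first free flight, for every noise sequence); `H_0 = P⁰_t F (z)`; and
`H_m = ∫ P⁰_{t−t_{m+1}} F (lstep_ξ z_m) γ(dξ)` by the *restart property*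
`lstate (ξ₀, ξ') y (k+1) = lstate ξ' (lstep_{ξ₀} y) k` (valid when the Lambertian instants from
`z_m` do not accumulate, an a.e. hypothesis of the item) and Fubini for `γ^ℕ ≅ γ ⊗ γ^ℕ`
(`Measure.infinitePi`: independence of the first coordinate from the shifted sequence).
The identity is proved for an ABSTRACT noise-driven recursion
(`LambertianSwap.swap_identity_of_restart`) and then instantiated to the route's `let` block
(`swapIdentity_proof`). Lindeberg replacement (Chatterjee 2006, Thm. 1.1) / consistency–stability
telescoping (Mischler–Mouhot 2013, §3) between two `N`-body gases sharing free flight and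
contact times; nothing is estimated here.
-/

namespace Summit.AtomisticToContinuum.HydrodynamicLimit.Theorems

open MeasureTheory ProbabilityTheory Set Filter Function
open scoped ENNReal Topology

namespace LambertianSwap

/-- If `A ⊆ ℕ` is bounded above and contains a successor, then `sup A = sup {k | k + 1 ∈ A} + 1`.
[folklore] -/
theorem nat_sSup_eq_sSup_shift_succ {A : Set ℕ} (hb : BddAbove A) {k₀ : ℕ} (hk₀ : k₀ + 1 ∈ A) :
    sSup A = sSup {k | k + 1 ∈ A} + 1 := by
  have hb' : BddAbove {k | k + 1 ∈ A} := by
    obtain ⟨b, hb⟩ := hb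
    exact ⟨b, fun k hk => (Nat.le_succ k).trans (hb hk)⟩
  have hmem : sSup A ∈ A := Nat.sSup_mem ⟨_, hk₀⟩ hb
  have hmem' : sSup {k | k + 1 ∈ A} ∈ {k | k + 1 ∈ A} := Nat.sSup_mem ⟨k₀, hk₀⟩ hb'
  refine le_antisymm ?_ (le_csSup hb hmem')
  have h1 : k₀ + 1 ≤ sSup A := le_csSup hb hk₀
  obtain ⟨M, hM⟩ : ∃ M, sSup A = M + 1 := ⟨sSup A - 1, by omega⟩
  rw [hM] at hmem ⊢
  exact Nat.succ_le_succ (le_csSup hb' hmem)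

/-- If `∑ₖ f k = ∞` in `ℝ≥0∞` then only finitely many partial sums stay below a finite level.
[folklore] -/
theorem bddAbove_partialSums_le_of_tsum_eq_top {f : ℕ → ℝ≥0∞} (h : ∑' k, f k = ∞) {c : ℝ≥0∞}
    (hc : c ≠ ∞) : BddAbove {k | ∑ m ∈ Finset.range k, f m ≤ c} := by
  have ht : Tendsto (fun k => ∑ m ∈ Finset.range k, f m) atTop (𝓝 ∞) := by
    have h' := ENNReal.tendsto_nat_tsum f
    rwa [h] at h'
  obtain ⟨k₀, hk₀⟩ := (ht.eventually (lt_mem_nhds hc.lt_top)).exists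
  refine ⟨k₀, fun k hk => ?_⟩
  by_contra hlt
  have hsub : Finset.range k₀ ⊆ Finset.range k := Finset.range_mono (not_le.1 hlt).le
  exact (lt_irrefl c) (hk₀.trans_le ((Finset.sum_le_sum_of_subset hsub).trans hk))

/-- The first coordinate and the shifted sequence split `Ξ^ℕ` measurably:
`ξ ↦ (ξ 0, (ξ (n+1))ₙ)` is a measurable embedding (indeed a measurable equivalence). [folklore] -/
theorem measurableEmbedding_uncons {Ξ : Type*} [MeasurableSpace Ξ] :
    MeasurableEmbedding (fun ξs : ℕ → Ξ => (ξs 0, fun n => ξs (n + 1))) := by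
  let e : (ℕ → Ξ) ≃ᵐ Ξ × (ℕ → Ξ) :=
    { toFun := fun ξs => (ξs 0, fun n => ξs (n + 1))
      invFun := fun p n => Nat.casesOn n p.1 p.2
      left_inv := fun ξs => funext fun n => by cases n <;> rfl
      right_inv := fun _ => rfl
      measurable_toFun :=
        (measurable_pi_apply 0).prodMk (measurable_pi_lambda _ fun n => measurable_pi_apply (n + 1))
      measurable_invFun := measurable_pi_lambda _ fun n => by
        cases n with
        | zero => exact measurable_fst
        | succ k => exact (measurable_pi_apply k).comp measurable_snd }
  exact e.measurableEmbedding

/-- **`γ^ℕ ≅ γ ⊗ γ^ℕ`.** Under the product of countably many copies of a probability measure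
`γ`, the pair (first coordinate, shifted sequence) has law `γ ⊗ γ^ℕ` (independence of disjoint
coordinate blocks, `ProbabilityTheory.indep_iSup_of_disjoint`, and shift-invariance,
`Measure.map_infinitePi_infinitePi_of_inj`). [folklore] -/
theorem infinitePi_map_uncons {Ξ : Type*} [MeasurableSpace Ξ] (γ : Measure Ξ)
    [IsProbabilityMeasure γ] :
    (Measure.infinitePi (fun _ : ℕ => γ)).map (fun ξs => (ξs 0, fun n => ξs (n + 1))) =
      γ.prod (Measure.infinitePi (fun _ : ℕ => γ)) := by
  set P := Measure.infinitePi (fun _ : ℕ => γ) with hP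
  have hind : IndepFun (fun ξs : ℕ → Ξ => ξs 0) (fun (ξs : ℕ → Ξ) (n : ℕ) => ξs (n + 1)) P := by
    have h1 : iIndepFun (fun (i : ℕ) (ξs : ℕ → Ξ) => ξs i) P :=
      iIndepFun_infinitePi (P := fun _ : ℕ => γ) (X := fun (_ : ℕ) (x : Ξ) => x)
        fun _ => measurable_id
    rw [iIndepFun_iff_iIndep] at h1
    have h2 := indep_iSup_of_disjoint
      (m := fun i : ℕ => MeasurableSpace.comap (fun ξs : ℕ → Ξ => ξs i) inferInstance)
      (fun i => (measurable_pi_apply i).comap_le) h1 (S := {0}) (T := Set.range Nat.succ)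
      (by
        rw [Set.disjoint_singleton_left]
        rintro ⟨n, hn⟩
        exact Nat.succ_ne_zero n hn)
    rw [IndepFun_iff_Indep]
    have hS : (⨆ i ∈ ({0} : Set ℕ),
        MeasurableSpace.comap (fun ξs : ℕ → Ξ => ξs i) (inferInstance : MeasurableSpace Ξ)) =
        MeasurableSpace.comap (fun ξs : ℕ → Ξ => ξs 0) inferInstance := by
      rw [iSup_singleton]
    have hT : (⨆ i ∈ Set.range Nat.succ,
        MeasurableSpace.comap (fun ξs : ℕ → Ξ => ξs i) (inferInstance : MeasurableSpace Ξ)) =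
        MeasurableSpace.comap (fun (ξs : ℕ → Ξ) (n : ℕ) => ξs (n + 1)) MeasurableSpace.pi := by
      rw [iSup_range, MeasurableSpace.pi, MeasurableSpace.comap_iSup]
      refine iSup_congr fun n => ?_
      rw [MeasurableSpace.comap_comp]
      rfl
    rw [← hS, ← hT]
    exact h2
  have h3 : P.map (fun (ξs : ℕ → Ξ) (n : ℕ) => ξs (n + 1)) = P :=
    Measure.map_infinitePi_infinitePi_of_inj (P := fun _ : ℕ => γ) (f := Nat.succ)
      Nat.succ_injective
  rw [(indepFun_iff_map_prod_eq_prod_map_map (measurable_pi_apply 0).aemeasurable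
      (measurable_pi_lambda _ fun n => measurable_pi_apply (n + 1)).aemeasurable).1 hind,
    Measure.infinitePi_map_eval, h3]

section Abstract

variable {C Ξ : Type*}

/-- Restart of an index-carrying iteration: running `k` steps from counter `n + 1` is running
`k` steps of the shifted recursion from counter `n`, with the counter shifted back. [folklore] -/
theorem iterate_indexed_succ (step : Ξ → C → C) (ξs : ℕ → Ξ) (y : C) (n k : ℕ) :
    (fun p : C × ℕ => (step (ξs p.2) p.1, p.2 + 1))^[k] (y, n + 1) =
      (((fun p : C × ℕ => (step (ξs (p.2 + 1)) p.1, p.2 + 1))^[k] (y, n)).1,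
        ((fun p : C × ℕ => (step (ξs (p.2 + 1)) p.1, p.2 + 1))^[k] (y, n)).2 + 1) := by
  induction k with
  | zero => rfl
  | succ k ih => rw [iterate_succ_apply', ih, iterate_succ_apply']

variable {τ : C → ℝ≥0∞} {S : ℝ → C → C} {step : Ξ → C → C}
  {lstate : (ℕ → Ξ) → C → ℕ → C} {linst : (ℕ → Ξ) → C → ℕ → ℝ≥0∞}
  {lflow : (ℕ → Ξ) → C → ℝ → C}

/-- `lstate ξ y 0 = y`. [folklore] -/
theorem lstate_zero
    (hlstate : ∀ ξs y k, lstate ξs y k =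
      ((fun p : C × ℕ => (step (ξs p.2) p.1, p.2 + 1))^[k] (y, 0)).1)
    (ξs : ℕ → Ξ) (y : C) : lstate ξs y 0 = y := by
  rw [hlstate]
  rfl

/-- **Restart property of the noise-driven states**:
`lstate (ξ₀, ξ') y (k + 1) = lstate ξ' (step ξ₀ y) k`. [folklore] -/
theorem lstate_succ
    (hlstate : ∀ ξs y k, lstate ξs y k =
      ((fun p : C × ℕ => (step (ξs p.2) p.1, p.2 + 1))^[k] (y, 0)).1)
    (ξs : ℕ → Ξ) (y : C) (k : ℕ) :
    lstate ξs y (k + 1) = lstate (fun n => ξs (n + 1)) (step (ξs 0) y) k := by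
  rw [hlstate, hlstate, iterate_succ_apply]
  show ((fun p : C × ℕ => (step (ξs p.2) p.1, p.2 + 1))^[k] (step (ξs 0) y, 0 + 1)).1 = _
  rw [iterate_indexed_succ]

/-- Restart property of the instants: `linst (ξ₀, ξ') y (k + 1) = τ y + linst ξ' (step ξ₀ y) k`.
[folklore] -/
theorem linst_succ
    (hlstate : ∀ ξs y k, lstate ξs y k =
      ((fun p : C × ℕ => (step (ξs p.2) p.1, p.2 + 1))^[k] (y, 0)).1)
    (hlinst : ∀ ξs y k, linst ξs y k = ∑ m ∈ Finset.range k, τ (lstate ξs y m))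
    (ξs : ℕ → Ξ) (y : C) (k : ℕ) :
    linst ξs y (k + 1) = τ y + linst (fun n => ξs (n + 1)) (step (ξs 0) y) k := by
  rw [hlinst, hlinst, Finset.sum_range_succ', lstate_zero hlstate, add_comm]
  congr 1
  exact Finset.sum_congr rfl fun m _ => by rw [lstate_succ hlstate]

/-- The instants are monotone in the number of steps. [folklore] -/
theorem linst_mono
    (hlinst : ∀ ξs y k, linst ξs y k = ∑ m ∈ Finset.range k, τ (lstate ξs y m))
    (ξs : ℕ → Ξ) (y : C) : Monotone (linst ξs y) := by
  intro k l hkl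
  rw [hlinst, hlinst]
  exact Finset.sum_le_sum_of_subset (Finset.range_mono hkl)

/-- **Before the first exit the noise-driven flow is free flight**: if `u < τ(y)` then
`lflow ξ y u = S u y` for every noise sequence. [folklore] -/
theorem lflow_eq_of_lt
    (hlstate : ∀ ξs y k, lstate ξs y k =
      ((fun p : C × ℕ => (step (ξs p.2) p.1, p.2 + 1))^[k] (y, 0)).1)
    (hlinst : ∀ ξs y k, linst ξs y k = ∑ m ∈ Finset.range k, τ (lstate ξs y m))
    (hlflow : ∀ ξs y u, lflow ξs y u =
      S (u - (linst ξs y (sSup {k | linst ξs y k ≤ ENNReal.ofReal u})).toReal)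
        (lstate ξs y (sSup {k | linst ξs y k ≤ ENNReal.ofReal u})))
    {ξs : ℕ → Ξ} {y : C} {u : ℝ} (h : ENNReal.ofReal u < τ y) : lflow ξs y u = S u y := by
  have h1 : linst ξs y 1 = τ y := by
    rw [hlinst, Finset.sum_range_one, lstate_zero hlstate]
  have hset : {k | linst ξs y k ≤ ENNReal.ofReal u} = {0} := by
    ext k
    simp only [mem_setOf_eq, mem_singleton_iff]
    refine ⟨fun hk => ?_, ?_⟩
    · by_contra hk0
      have hle : linst ξs y 1 ≤ linst ξs y k :=
        linst_mono hlinst ξs y (Nat.one_le_iff_ne_zero.2 hk0)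
      rw [h1] at hle
      exact (not_le.2 h) (hle.trans hk)
    · rintro rfl
      rw [hlinst, Finset.sum_range_zero]
      exact zero_le
  rw [hlflow, hset, csSup_singleton, hlinst, Finset.sum_range_zero, ENNReal.toReal_zero, sub_zero,
    lstate_zero hlstate]

/-- **Restart property of the noise-driven flow.** If the first exit time `τ(y)` is at most
`u` and the instants from `y` do not accumulate before `u`, then
`lflow (ξ₀, ξ') y u = lflow ξ' (step ξ₀ y) (u - τ(y))`. [folklore] -/
theorem lflow_restart
    (hlstate : ∀ ξs y k, lstate ξs y k =
      ((fun p : C × ℕ => (step (ξs p.2) p.1, p.2 + 1))^[k] (y, 0)).1)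
    (hlinst : ∀ ξs y k, linst ξs y k = ∑ m ∈ Finset.range k, τ (lstate ξs y m))
    (hlflow : ∀ ξs y u, lflow ξs y u =
      S (u - (linst ξs y (sSup {k | linst ξs y k ≤ ENNReal.ofReal u})).toReal)
        (lstate ξs y (sSup {k | linst ξs y k ≤ ENNReal.ofReal u})))
    {ξs : ℕ → Ξ} {y : C} {u : ℝ} (hτ : τ y ≤ ENNReal.ofReal u)
    (hb : BddAbove {k | linst ξs y k ≤ ENNReal.ofReal u}) :
    lflow ξs y u = lflow (fun n => ξs (n + 1)) (step (ξs 0) y) (u - (τ y).toReal) := by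
  set ξs' : ℕ → Ξ := fun n => ξs (n + 1) with hξs'
  set y' := step (ξs 0) y with hy'
  have hτtop : τ y ≠ ∞ := ne_top_of_le_ne_top ENNReal.ofReal_ne_top hτ
  have hsub : ENNReal.ofReal (u - (τ y).toReal) = ENNReal.ofReal u - τ y := by
    rw [ENNReal.ofReal_sub _ ENNReal.toReal_nonneg, ENNReal.ofReal_toReal hτtop]
  have hiff : ∀ k, linst ξs y (k + 1) ≤ ENNReal.ofReal u ↔
      linst ξs' y' k ≤ ENNReal.ofReal (u - (τ y).toReal) := by
    intro k
    rw [linst_succ hlstate hlinst, hsub]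
    refine ⟨ENNReal.le_sub_of_add_le_left hτtop, fun hk => ?_⟩
    calc τ y + linst ξs' y' k ≤ τ y + (ENNReal.ofReal u - τ y) := add_le_add le_rfl hk
      _ = ENNReal.ofReal u := add_tsub_cancel_of_le hτ
  have hset : {k | linst ξs' y' k ≤ ENNReal.ofReal (u - (τ y).toReal)} =
      {k | k + 1 ∈ {k | linst ξs y k ≤ ENNReal.ofReal u}} := by
    ext k
    simp only [mem_setOf_eq]
    exact (hiff k).symm
  have h1 : 0 + 1 ∈ {k | linst ξs y k ≤ ENNReal.ofReal u} := by
    show linst ξs y (0 + 1) ≤ ENNReal.ofReal u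
    rw [linst_succ hlstate hlinst, hlinst, Finset.sum_range_zero, add_zero]
    exact hτ
  have hS : sSup {k | linst ξs y k ≤ ENNReal.ofReal u} =
      sSup {k | linst ξs' y' k ≤ ENNReal.ofReal (u - (τ y).toReal)} + 1 := by
    rw [hset]
    exact nat_sSup_eq_sSup_shift_succ hb h1
  set M' := sSup {k | linst ξs' y' k ≤ ENNReal.ofReal (u - (τ y).toReal)} with hM'
  have hb' : BddAbove {k | linst ξs' y' k ≤ ENNReal.ofReal (u - (τ y).toReal)} := by
    rw [hset]
    obtain ⟨b, hb⟩ := hb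
    exact ⟨b, fun k hk => (Nat.le_succ k).trans (hb hk)⟩
  have hmem' : M' ∈ {k | linst ξs' y' k ≤ ENNReal.ofReal (u - (τ y).toReal)} := by
    refine Nat.sSup_mem ⟨0, ?_⟩ hb'
    show linst ξs' y' 0 ≤ _
    rw [hlinst, Finset.sum_range_zero]
    exact zero_le
  have hfin : linst ξs' y' M' ≠ ∞ := ne_top_of_le_ne_top ENNReal.ofReal_ne_top hmem'
  rw [hlflow, hlflow ξs', hS, lstate_succ hlstate, linst_succ hlstate hlinst,
    ENNReal.toReal_add hτtop hfin]
  congr 1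
  ring

/-- **The abstract swap identity.** Data: an exit time `τ`, a free flight `S`, a random step
`step ξ` driven by marks `ξ` of law `γ`, the noise-driven states/instants/flow
`lstate`/`linst`/`lflow` (given by their defining equations), a bounded measurable observable
`F` with `PF u y = ∫ F (lflow ξ y u) dγ^ℕ(ξ)`, and a deterministic sequence of states `zs` with
instants `ts k = Σ_{m<k} τ(zs m)` such that `t ∈ [ts K, ts (K+1))`. If the Lambertian instants
from each `zs m` almost surely do not accumulate, then
`F(S_{t - ts K} (zs K)) − PF t (zs 0) = Σ_{m<K} [PF (t − ts (m+1)) (zs (m+1)) − ∫ PF (t − ts (m+1)) (step ξ (zs m)) dγ(ξ)]`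
(telescoping over `H_m := PF (t − ts m) (zs m)`; Lindeberg/Trotter replacement,
Chatterjee 2006 Thm. 1.1; Mischler–Mouhot 2013 §3). [folklore] -/
theorem swap_identity_of_restart [MeasurableSpace C] [MeasurableSpace Ξ]
    {γ : Measure Ξ} [IsProbabilityMeasure γ]
    (hlstate : ∀ ξs y k, lstate ξs y k =
      ((fun p : C × ℕ => (step (ξs p.2) p.1, p.2 + 1))^[k] (y, 0)).1)
    (hlinst : ∀ ξs y k, linst ξs y k = ∑ m ∈ Finset.range k, τ (lstate ξs y m))
    (hlflow : ∀ ξs y u, lflow ξs y u =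
      S (u - (linst ξs y (sSup {k | linst ξs y k ≤ ENNReal.ofReal u})).toReal)
        (lstate ξs y (sSup {k | linst ξs y k ≤ ENNReal.ofReal u})))
    (hmeas : ∀ u, Measurable (fun p : C × (ℕ → Ξ) => lflow p.2 p.1 u))
    {F : C → ℝ} (hF : Measurable F) (hFb : ∀ z, |F z| ≤ 1)
    {PF : ℝ → C → ℝ}
    (hPF : ∀ u y, PF u y = ∫ ξs, F (lflow ξs y u) ∂(Measure.infinitePi fun _ : ℕ => γ))
    {zs : ℕ → C} {ts : ℕ → ℝ≥0∞} (hts : ∀ k, ts k = ∑ m ∈ Finset.range k, τ (zs m))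
    {t : ℝ} (ht : 0 ≤ t) {K : ℕ} (hK1 : ts K ≤ ENNReal.ofReal t)
    (hK2 : ENNReal.ofReal t < ts (K + 1))
    (hacc : ∀ m, ∀ᵐ ξs ∂(Measure.infinitePi fun _ : ℕ => γ), ∑' k, τ (lstate ξs (zs m) k) = ∞) :
    F (S (t - (ts K).toReal) (zs K)) - PF t (zs 0) =
      ∑ m ∈ Finset.range K, (PF (t - (ts (m + 1)).toReal) (zs (m + 1)) -
        ∫ ξ, PF (t - (ts (m + 1)).toReal) (step ξ (zs m)) ∂γ) := by
  set P : Measure (ℕ → Ξ) := Measure.infinitePi fun _ : ℕ => γ with hP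
  have hts_succ : ∀ k, ts (k + 1) = ts k + τ (zs k) := fun k => by
    rw [hts, hts, Finset.sum_range_succ]
  have hts_mono : Monotone ts := fun k l hkl => by
    rw [hts, hts]
    exact Finset.sum_le_sum_of_subset (Finset.range_mono hkl)
  -- the telescoping sequence
  set H : ℕ → ℝ := fun m => PF (t - (ts m).toReal) (zs m) with hH
  have hH0 : H 0 = PF t (zs 0) := by
    simp only [hH, hts, Finset.sum_range_zero, ENNReal.toReal_zero, sub_zero]
  have hHK : H K = F (S (t - (ts K).toReal) (zs K)) := by
    have hlt : ENNReal.ofReal (t - (ts K).toReal) < τ (zs K) :=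
      Literature.Analysis.FluidPDE.Alexander.ofReal_sub_toReal_lt ht hK1 (by rwa [← hts_succ])
    simp only [hH, hPF]
    have hconst : (fun ξs : ℕ → Ξ => F (lflow ξs (zs K) (t - (ts K).toReal))) =
        fun _ => F (S (t - (ts K).toReal) (zs K)) := by
      funext ξs
      rw [lflow_eq_of_lt hlstate hlinst hlflow hlt]
    rw [hconst, integral_const, probReal_univ, one_smul]
  -- the swap step
  have hstep : ∀ m, m < K →
      H m = ∫ ξ, PF (t - (ts (m + 1)).toReal) (step ξ (zs m)) ∂γ := by
    intro m hm
    have hm1 : ts (m + 1) ≤ ENNReal.ofReal t := (hts_mono (Nat.succ_le_of_lt hm)).trans hK1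
    have hm1top : ts (m + 1) ≠ ∞ := ne_top_of_le_ne_top ENNReal.ofReal_ne_top hm1
    have hm0 : ts m ≤ ENNReal.ofReal t := (hts_mono (Nat.le_succ m)).trans hm1
    have hm0top : ts m ≠ ∞ := ne_top_of_le_ne_top ENNReal.ofReal_ne_top hm0
    have hτtop : τ (zs m) ≠ ∞ := by
      intro h
      rw [hts_succ, h, add_top] at hm1top
      exact hm1top rfl
    set u : ℝ := t - (ts m).toReal with hu
    set u' : ℝ := t - (ts (m + 1)).toReal with hu'
    have huu' : u' = u - (τ (zs m)).toReal := by
      rw [hu, hu', hts_succ, ENNReal.toReal_add hm0top hτtop]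
      ring
    have hτu : τ (zs m) ≤ ENNReal.ofReal u := by
      rw [hu, ENNReal.ofReal_sub _ ENNReal.toReal_nonneg, ENNReal.ofReal_toReal hm0top]
      refine ENNReal.le_sub_of_add_le_left hm0top ?_
      rwa [← hts_succ]
    -- the integrand after the swap, as a function of (first mark, remaining marks)
    set g : Ξ × (ℕ → Ξ) → ℝ := fun p => F (lflow p.2 (step p.1 (zs m)) u') with hg
    have hmeas_m : Measurable fun ξs : ℕ → Ξ => F (lflow ξs (zs m) u) :=
      hF.comp ((hmeas u).comp (measurable_const.prodMk measurable_id))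
    have hae : (fun ξs : ℕ → Ξ => F (lflow ξs (zs m) u)) =ᵐ[P]
        fun ξs => g (ξs 0, fun n => ξs (n + 1)) := by
      filter_upwards [hacc m] with ξs hξs
      have hb : BddAbove {k | linst ξs (zs m) k ≤ ENNReal.ofReal u} := by
        have hb' := bddAbove_partialSums_le_of_tsum_eq_top hξs (c := ENNReal.ofReal u)
          ENNReal.ofReal_ne_top
        refine hb'.mono fun k hk => ?_
        simp only [mem_setOf_eq] at hk ⊢
        rwa [← hlinst]
      show F (lflow ξs (zs m) u) = F (lflow (fun n => ξs (n + 1)) (step (ξs 0) (zs m)) u')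
      rw [lflow_restart hlstate hlinst hlflow hτu hb, huu']
    have hemb := measurableEmbedding_uncons (Ξ := Ξ)
    have hgm : AEStronglyMeasurable g (γ.prod P) := by
      rw [← infinitePi_map_uncons γ]
      exact hemb.aestronglyMeasurable_map_iff.2 (hmeas_m.aestronglyMeasurable.congr hae)
    have hint : Integrable g (γ.prod P) := by
      refine Integrable.of_bound hgm 1 (Eventually.of_forall fun p => ?_)
      rw [Real.norm_eq_abs]
      exact hFb _
    calc H m = ∫ ξs, F (lflow ξs (zs m) u) ∂P := hPF _ _
      _ = ∫ ξs, g (ξs 0, fun n => ξs (n + 1)) ∂P := integral_congr_ae hae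
      _ = ∫ p, g p ∂(P.map fun ξs => (ξs 0, fun n => ξs (n + 1))) :=
          (hemb.integral_map g).symm
      _ = ∫ p, g p ∂(γ.prod P) := by rw [infinitePi_map_uncons]
      _ = ∫ ξ, ∫ ξs, g (ξ, ξs) ∂P ∂γ := integral_prod g hint
      _ = ∫ ξ, PF u' (step ξ (zs m)) ∂γ := by simp only [hg, hPF]
  -- telescoping
  rw [← hHK, ← hH0, ← Finset.sum_range_sub H K]
  refine Finset.sum_congr rfl fun m hm => ?_
  rw [hstep m (Finset.mem_range.1 hm)]

end Abstract

end LambertianSwap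

/-- **The exact hybrid (Trotter–Lindeberg) swap identity** for the deterministic hard-sphere
flow and the Lambertian gas of route `LambertianContactSwap` (item `SwapIdentity`,
stmt-AtomisticToContinuum-12100): for `0 < σ < 1/2`, `N`, `t ≥ 0`, a measurable `F` bounded
by `1`, a good datum `z` and almost surely non-accumulating Lambertian continuations from the
post-collisional states of `z`,
`F(Φ_t z) − E F(Λ_t(z, ·)) = Σ_{m < K_t(z)} [(P⁰_{t−t_{m+1}} F)(collisionStep z_m) − ∫ (P⁰_{t−t_{m+1}} F)(lstep_ξ z_m) γ(dξ)]`
with `P⁰_u F (y) = E F(Λ_u(y, ·))`. Proof: the deterministic orbit of a good datum has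
`t ∈ [t_K, t_{K+1})` for `K = collisionCount z t`
(`Alexander.FwdGood.exists_segment`), and `LambertianSwap.swap_identity_of_restart` applies to the
route's `let` block. [folklore] -/
theorem swapIdentity_proof :
    Summit.AtomisticToContinuum.HydrodynamicLimit.Theses.LambertianContactSwap.SwapIdentity := by
  delta Summit.AtomisticToContinuum.HydrodynamicLimit.Theses.LambertianContactSwap.SwapIdentity
  intro Cfg G ε τ S ldir lpair lstep lstate linst lflow noise σ hσ hσ' N t ht hmeas F hF hFb z hz
    hacc PF
  have hgood : Literature.Analysis.FluidPDE.Alexander.FwdGood G (ε σ N) z := hz.2.2.1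
  obtain ⟨K, hK1, hK2⟩ := hgood.exists_segment t
  rw [Literature.Analysis.FluidPDE.Alexander.collisionCount_eq_of_segment hK1 hK2,
    Literature.Analysis.FluidPDE.Alexander.fwdFlow_eq_of_segment hK1 hK2]
  have key := LambertianSwap.swap_identity_of_restart (C := Cfg N) (Ξ := EuclideanSpace ℝ (Fin 3))
    (γ := stdGaussian (EuclideanSpace ℝ (Fin 3))) (τ := τ σ N) (S := fun u y => S u N y)
    (step := lstep σ N) (lstate := lstate σ N) (linst := linst σ N) (lflow := lflow σ N)
    (fun _ _ _ => rfl) (fun _ _ _ => rfl) (fun _ _ _ => rfl) hmeas hF hFb (PF := PF)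
    (fun _ _ => rfl) (zs := Literature.Analysis.FluidPDE.Alexander.stateAfter G (ε σ N) z)
    (ts := Literature.Analysis.FluidPDE.Alexander.collisionInstant G (ε σ N) z) (fun _ => rfl)
    ht hK1 hK2 hacc
  simpa [Literature.Analysis.FluidPDE.Alexander.stateAfter_succ] using key

end Summit.AtomisticToContinuum.HydrodynamicLimit.Theorems
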